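import Literature.IUT.HodgeTheaters.ThetaHodgeTheatersRemarksA2
import Literature.AnabelianGeometry.AbsoluteAnabelian.AutHolomorphicSpacesTransportProofs
import Mathlib.Analysis.Calculus.Deriv.Star
import Mathlib.RingTheory.Algebraic.Basic
import HarnessLib

/-!
# [IUTchI] Rmk 3.4.3 (ii): NON-VACUITY of the interface `S3RemarksLocal.AutHolSpaceNF` at a GENUINE model

S. Mochizuki, *Inter-universal Teichmüller theory I*, §3, Remark 3.4.3 (ii) (kurims final manuscript
May 2020, p. 83): "the set of NF-points [i.e., points defined over a number field] of the underlying
topological space of the Aut-holomorphic space `D_v` may be reconstructed via a functorial algorithm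
from the [abstract] Aut-holomorphic space `D_v`" [cite: Mochizuki2012, Rmk 3.4.3 (ii) p.83]
[claim: Mochizuki2012, status: disputed].

PROOF-ONLY non-vacuity file (abc-iut cell, seat abc-iut-L6-t15 gen 4; row family «NV-L5/<Interface>»,
abc-iut-L5-lead RULINGS #27; interface typed by abc-iut-L3-t8 in `ThetaHodgeTheatersRemarksA2.lean`).
No `def`, `instance` or `structure` is declared: every witness is built inside a theorem term.

WHAT IS WITNESSED.  The record `S3RemarksLocal.AutHolSpaceNF` (carrier, topology, a subgroup `autHol`
of self-homeomorphisms, a subset `nfPoints`) carries no constraint, so its bare inhabitation is trivial;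
the content of this file is the GENUINE archimedean model the remark speaks about:

* `S3RemarksLocal.AutHolSpaceNF.nonempty_model` — the Aut-holomorphic space of the hyperbolic curve
  `P¹ ∖ {0, 1, ∞}` over `ℚ` at an archimedean place: carrier the open subset `ℂ ∖ {0, 1}` of `ℂ` (a
  Riemann surface through Mathlib's charted-space structure on opens), `autHol :=` the group
  `Aut^hol(ℂ ∖ {0,1})` of biholomorphic self-homeomorphisms — abc-iut-L4's REAL definition `holAut`
  ([AbsTopIII] Def. 2.1 (i), `AutHolomorphicSpaces.lean`) — and `nfPoints :=` the points algebraic over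
  `ℚ` (= the `ℚ̄`-points of `P¹ ∖ {0,1,∞}`);
* `S3RemarksLocal.AutHolSpaceNF.model_conj_isIso` — at that model, complex conjugation (the archimedean
  Galois element) IS an isomorphism of abstract Aut-holomorphic spaces in the typed sense
  `AutHolSpaceNF.IsIso` (it conjugates `Aut^hol` onto itself: `z ↦ conj (φ (conj z))` is holomorphic iff
  `φ` is — Mathlib `differentiableAt_conj_conj_iff`) AND carries NF-points onto NF-points — so the typed
  functoriality predicate `NFPointsFunctorial X X` is met by a non-identity isomorphism at the genuine
  model (a kernel sanity check of the reading; the predicate itself is NOT asserted here).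

HONEST LABEL: `_model` = genuine printed object (the `D_v` of [IUTchI] Ex. 3.4 is the Aut-holomorphic
space of a hyperbolic curve over a number field at `v | ∞`; `P¹_ℚ ∖ {0,1,∞}` is the simplest one).
Nothing here takes a side on [IUTchIII] Cor. 3.12 (nor asserts anything of [IUTchI]); instantiated ≠
endorsed; a non-vacuity witness says only that the interface is met by the printed kind of object.
-/

noncomputable section

namespace Literature.IUT.HodgeTheaters

open _root_.TopologicalSpace _root_.Topology _root_.Set
open scoped _root_.Manifold _root_.ContDiff ComplexConjugate
open Literature.AnabelianGeometry.AbsoluteAnabelian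

/-! ### The carrier `ℂ ∖ {0, 1}` -/

/-- Complex conjugation preserves `ℂ ∖ {0,1}`. [cite: Mochizuki2012, Rmk 3.4.3 (ii) p.83] -/
theorem conj_mem_compl_zero_one {z : ℂ} (hz : z ∈ {z : ℂ | z ≠ 0 ∧ z ≠ 1}) :
    conj z ∈ {z : ℂ | z ≠ 0 ∧ z ≠ 1} :=
  ⟨fun h => hz.1 (by simpa using congrArg conj h), fun h => hz.2 (by simpa using congrArg conj h)⟩

/-- Conjugates of `ℚ`-algebraic points of `ℂ ∖ {0,1}` are `ℚ`-algebraic (Galois conjugation preserves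
NF-points). [cite: Mochizuki2012, Rmk 3.4.3 (ii) p.83] -/
theorem isAlgebraic_conj_of_mem {z : ℂ} (_hz : z ∈ {z : ℂ | z ≠ 0 ∧ z ≠ 1}) (ha : IsAlgebraic ℚ z) :
    IsAlgebraic ℚ (conj z) := by
  simpa using ha.algHom ((Complex.conjAe.restrictScalars ℚ).toAlgHom)

/-! ### The genuine model -/

/-- **NV-L5 / [IUTchI] Rmk 3.4.3 (ii) — GENUINE MODEL.**  The interface `S3RemarksLocal.AutHolSpaceNF`
("an Aut-holomorphic space with its NF-points") is inhabited by the Aut-holomorphic space of the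
hyperbolic curve `P¹_ℚ ∖ {0, 1, ∞}`: carrier `ℂ ∖ {0,1}` (open subset of `ℂ`, hence a Riemann surface),
`autHol := holAut` = the biholomorphic self-homeomorphisms ([AbsTopIII] Def. 2.1 (i), abc-iut-L4
`AutHolomorphicSpaces`), `nfPoints :=` the `ℚ̄`-points `{z | IsAlgebraic ℚ z}`.  Witness built inside
the term; no definition declared. [cite: Mochizuki2012, Rmk 3.4.3 (ii) p.83] -/
theorem S3RemarksLocal.AutHolSpaceNF.nonempty_model :
    ∃ X : S3RemarksLocal.AutHolSpaceNF.{0},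
      X = { carrier := ↥(⟨{z : ℂ | z ≠ 0 ∧ z ≠ 1}, isOpen_ne.inter isOpen_ne⟩ : Opens ℂ)
            autHol := holAut (⟨{z : ℂ | z ≠ 0 ∧ z ≠ 1}, isOpen_ne.inter isOpen_ne⟩ : Opens ℂ)
            nfPoints := {x | IsAlgebraic ℚ (x : ℂ)} } :=
  ⟨_, rfl⟩

/-- The bare `Nonempty` form of `nonempty_model` (for the §4(iii) census: the type is inhabited, by a
GENUINE model). [cite: Mochizuki2012, Rmk 3.4.3 (ii) p.83] -/
theorem S3RemarksLocal.AutHolSpaceNF.nonempty : Nonempty S3RemarksLocal.AutHolSpaceNF.{0} :=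
  let ⟨X, _⟩ := S3RemarksLocal.AutHolSpaceNF.nonempty_model
  ⟨X⟩

/-! ### Complex conjugation is an isomorphism of the model preserving NF-points -/

/-- For a self-map `ψ` of an open `U ⊆ ℂ` that is the restriction of an ambient `Φ : ℂ → ℂ`:
`ψ` is holomorphic (Mathlib `MDifferentiable` for `𝓘(ℂ, ℂ)`) iff `Φ` is `ℂ`-differentiable at every
point of `U`. [cite: Mochizuki2012, Rmk 3.4.3 (ii) p.83] -/
theorem mdifferentiable_opens_self_iff {U : Opens ℂ} {Φ : ℂ → ℂ} {ψ : U → U}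
    (hψ : ∀ x, (ψ x : ℂ) = Φ x) :
    MDifferentiable 𝓘(ℂ, ℂ) 𝓘(ℂ, ℂ) ψ ↔ ∀ x : U, DifferentiableAt ℂ Φ x := by
  refine forall_congr' fun x => ?_
  rw [mdifferentiableAt_opens_iff hψ x]
  exact mdifferentiableAt_iff_differentiableAt

/-- **[IUTchI] Rmk 3.4.3 (ii) at the GENUINE MODEL — complex conjugation.**  Let `X` be the model of
`nonempty_model` (`ℂ ∖ {0,1}`, `Aut^hol`, `ℚ̄`-points) and `c : X ≃ₜ X` complex conjugation.  Then
(1) `c` is an isomorphism of abstract Aut-holomorphic spaces in the typed sense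
`S3RemarksLocal.AutHolSpaceNF.IsIso X X c` — conjugating by `c` carries `Aut^hol(ℂ ∖ {0,1})` onto itself,
because `z ↦ conj (φ (conj z))` is holomorphic iff `φ` is (`differentiableAt_conj_conj_iff`) — and
(2) `c '' nfPoints = nfPoints` (Galois conjugates of algebraic numbers are algebraic).  So the typed
functoriality reading `NFPointsFunctorial X X` is met by a NON-identity isomorphism at the genuine model
(kernel sanity of the typing; the predicate itself is not asserted).
[cite: Mochizuki2012, Rmk 3.4.3 (ii) p.83] -/
theorem S3RemarksLocal.AutHolSpaceNF.model_conj_isIso :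
    let U : Opens ℂ := ⟨{z : ℂ | z ≠ 0 ∧ z ≠ 1}, isOpen_ne.inter isOpen_ne⟩
    let X : S3RemarksLocal.AutHolSpaceNF.{0} :=
      { carrier := ↥U, autHol := holAut U, nfPoints := {x | IsAlgebraic ℚ (x : ℂ)} }
    ∃ c : X.carrier ≃ₜ X.carrier,
      (∀ x : X.carrier, ((c x : ↥U) : ℂ) = conj ((x : ↥U) : ℂ)) ∧
      S3RemarksLocal.AutHolSpaceNF.IsIso X X c ∧ c '' X.nfPoints = X.nfPoints := by
  intro U X
  -- complex conjugation restricted to `U`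
  let c : (↥U) ≃ₜ (↥U) :=
    { toFun := fun x => ⟨conj (x : ℂ), conj_mem_compl_zero_one x.2⟩
      invFun := fun x => ⟨conj (x : ℂ), conj_mem_compl_zero_one x.2⟩
      left_inv := fun x => Subtype.ext (by simp)
      right_inv := fun x => Subtype.ext (by simp)
      continuous_toFun := by
        exact (Complex.continuous_conj.comp continuous_subtype_val).subtype_mk _
      continuous_invFun := by
        exact (Complex.continuous_conj.comp continuous_subtype_val).subtype_mk _ }
  have hc : ∀ x : ↥U, ((c x : ↥U) : ℂ) = conj ((x : ↥U) : ℂ) := fun _ => rfl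
  have hcs : ∀ x : ↥U, ((c.symm x : ↥U) : ℂ) = conj ((x : ↥U) : ℂ) := fun _ => rfl
  -- key: for any self-homeomorphism `φ` of `U`, `c⁻¹ ∘ φ ∘ c` is holomorphic iff `φ` is
  have key : ∀ φ : (↥U) ≃ₜ (↥U),
      MDifferentiable 𝓘(ℂ, ℂ) 𝓘(ℂ, ℂ) (⇑((c.trans φ).trans c.symm)) ↔
        MDifferentiable 𝓘(ℂ, ℂ) 𝓘(ℂ, ℂ) (⇑φ) := by
    intro φ
    classical
    -- ambient extension of `φ`
    let Φ : ℂ → ℂ := fun z => if h : z ∈ U then ((φ ⟨z, h⟩ : ↥U) : ℂ) else 0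
    have hΦ : ∀ x : ↥U, ((φ x : ↥U) : ℂ) = Φ x := fun x => by
      simp only [Φ, dif_pos x.2]
    have hΨ : ∀ x : ↥U, ((((c.trans φ).trans c.symm) x : ↥U) : ℂ) = (conj ∘ Φ ∘ conj) (x : ℂ) := by
      intro x
      change ((c.symm (φ (c x)) : ↥U) : ℂ) = conj (Φ (conj (x : ℂ)))
      rw [hcs, hΦ]
      rfl
    rw [mdifferentiable_opens_self_iff hΦ, mdifferentiable_opens_self_iff hΨ]
    constructor
    · intro h x
      have hx' : conj (x : ℂ) ∈ U := conj_mem_compl_zero_one x.2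
      have := h ⟨conj (x : ℂ), hx'⟩
      rw [differentiableAt_conj_conj_iff] at this
      simpa using this
    · intro h x
      rw [differentiableAt_conj_conj_iff]
      exact h ⟨conj (x : ℂ), conj_mem_compl_zero_one x.2⟩
  refine ⟨c, hc, ?_, ?_⟩
  · -- `IsIso`: membership in `holAut U` is preserved by conjugation with `c`, both directions
    intro φ
    change φ ∈ holAut U ↔ (c.trans φ).trans c.symm ∈ holAut U
    rw [mem_holAut_iff, mem_holAut_iff]
    have hsymm : ((c.trans φ).trans c.symm).symm = (c.trans φ.symm).trans c.symm := by
      ext x; rfl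
    rw [hsymm, key φ, key φ.symm]
  · -- NF-points are carried onto NF-points
    ext x
    constructor
    · rintro ⟨y, hy, rfl⟩
      change IsAlgebraic ℚ (conj (y : ℂ))
      exact isAlgebraic_conj_of_mem y.2 hy
    · intro hx
      refine ⟨c.symm x, ?_, c.apply_symm_apply x⟩
      change IsAlgebraic ℚ (conj (x : ℂ))
      exact isAlgebraic_conj_of_mem x.2 hx

end Literature.IUT.HodgeTheaters

end
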